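import Literature.AlgebraicGeometry.ShimuraVarieties.UnitaryBallQuotientDatum
import Literature.NumberTheory.Automorphic.UnitaryGroupDirectSum
import Literature.NumberTheory.Automorphic.UnitaryGroupFormTransport
import Literature.NumberTheory.Automorphic.UnitaryGroupIsotropicLineElements
import HarnessLib

/-!
# Frames adapted to an anisotropic line: `ᵗσ(B)·H·B = J⋆ ⊕ᶠ (⟨w,w⟩)`

[BergeronMillsonMoeglin2016Balls] Part 2 §1.1 and §3.1 (an anisotropic hermitian space `V` over a CM field and the
orthogonal decomposition `V = W^⊥ ⊕ W` along a totally positive definite subspace `W`, carrying the special cycle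
of `W`); [Milne2005ShimuraVarieties] Def. 12.5 / Rem. 12.6 p. 113 (the frame in which a special pair is read).
Pure linear algebra over a field `E` with a ring endomorphism `σ` and a Gram matrix `H ∈ M_{n+1}(E)`
(`⟨u, v⟩ = ᵗσ(u)·H·v`, ★ `hermForm`):

* §1 `formCongr_apply_eq_hermForm`: the entries of `ᵗσ(B)·H·B` (★ `formCongr`) are the pairings of the columns of `B`;
  the entries of the `Fin`-indexed direct sum `J₁ ⊕ᶠ J₂` (★ `UnitaryGroup.finSum`) at `castSucc`/`last` for `N₂ = 1`.
* §2 **`exists_frame_formCongr_eq_finSum_of_hermForm_self_ne_zero`**: if `⟨·,·⟩` is symmetric with respect to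
  vanishing (`⟨u,v⟩ = 0 → ⟨v,u⟩ = 0`; e.g. `σ` an involution and `H` `σ`-hermitian,
  `hermForm_eq_zero_symm_of_transpose_map_eq`) and `w` is ANISOTROPIC (`⟨w,w⟩ ≠ 0`), then there is a frame
  `B ∈ GL_{n+1}(E)` whose last column is `w`, whose first `n` columns form a basis of `w^⊥ = {v ∣ ⟨w,v⟩ = 0}`, and whose
  Gram matrix is block diagonal: `ᵗσ(B)·H·B = J⋆ ⊕ᶠ (⟨w,w⟩)` with `J⋆ ∈ M_n(E)` the Gram matrix of `w^⊥` in that basis.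
  (No anisotropy of `H` on `w^⊥` is needed: the first `n` columns are ANY basis of the kernel of `v ↦ ⟨w,v⟩`.)
* §3 **`exists_frame_formCongr_eq_finSum_of_isTotallyPositive`**: the same for a totally positive definite LINE
  `W ⊆ E^{n+1}` over a number field (★ `IsTotallyPositive`, `finrank W = 1`): `ᵗσ(B)·H·B = J⋆ ⊕ᶠ J⊥` with
  `0 < Re τ(J⊥₀₀)` at every `τ : E →+* ℂ`, last column spanning `W`, first `n` columns spanning `W^⊥`.
  For `n = 2` these are exactly the numerics `(J⋆, J⊥, B, hB, hpos)` of a block-diagonal embedding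
  `U(J⋆) × U(J⊥) ↪ U(H)` adapted to `W` (the tree's `finAdelicBlockDiag 2 1 J⋆ J⊥` / `finAdelicCongr … B … hB`).

Everything is elementary and proved ([folklore] throughout; the geometric context is BMM Part 2 §3.1).  Nothing about
Shimura varieties is asserted here.  Written for the cell `hodgecm-mathlib` (A-plan2 `GS-PROGRAMME.md` §4 F3 «frame
lemma», generalised from `n + 1 = 3` to any `n + 1` and from CM fields to any `(E, σ)`).
-/

noncomputable section

open Matrix

namespace Literature.AlgebraicGeometry.ShimuraVarieties

open Literature.NumberTheory.Automorphic

/-! ## §1 Entries of `ᵗσ(B)·H·B` and of `J₁ ⊕ᶠ J₂` -/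

section Entries

variable {R : Type*} [CommRing R]

/-- The two spellings of the pairing `ᵗσ(u)·H·v` in the tree (this directory's `hermForm` and
`UnitaryGroup.hermForm` of `NumberTheory/Automorphic`) agree definitionally (plumbing). [folklore] -/
private theorem hermForm_eq_unitaryGroupHermForm {m : Type*} [Fintype m] (σ : R →+* R) (H : Matrix m m R) (u v : m → R) :
    hermForm σ H u v = UnitaryGroup.hermForm σ H u v := rfl

/-- **The Gram matrix of a frame**: `(ᵗσ(B)·H·B)_{kl} = ⟨B e_k, B e_l⟩`, the pairing of the `k`-th and `l`-th columns
of `B` (BMM Part 2 §1.1: the hermitian form in coordinates). [cite: BergeronMillsonMoeglin2016Balls, Part 2 §1.1] -/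
theorem formCongr_apply_eq_hermForm {m : Type*} [Fintype m] [DecidableEq m] (σ : R →+* R) (B : GL m R)
    (H : Matrix m m R) (k l : m) :
    formCongr σ B H k l =
      hermForm σ H (fun i => (B : Matrix m m R) i k) (fun i => (B : Matrix m m R) i l) := by
  simp only [formCongr]
  rw [Matrix.mul_assoc, Matrix.mul_apply]
  rfl

/-- `σ`-hermitian matrices entrywise: `σ(H i j) = H j i` for all `i, j` gives `ᵗσ(H) = H` (plumbing between the two
spellings of hermitian symmetry in the tree). [folklore] -/
private theorem transpose_map_eq_of_forall_map_apply {m : Type*} (σ : R →+* R) {H : Matrix m m R}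
    (hH : ∀ i j, σ (H i j) = H j i) : (H.map σ)ᵀ = H :=
  Matrix.ext fun i j => by rw [transpose_apply, map_apply]; exact hH j i

/-- For `σ` an involution and `H` `σ`-hermitian, orthogonality is symmetric: `⟨u,v⟩ = 0 → ⟨v,u⟩ = 0`
(`⟨v,u⟩ = σ⟨u,v⟩`, ★ `UnitaryGroup.conj_hermForm`; BMM Part 2 §1.1, hermitian forms over a CM field).
[cite: BergeronMillsonMoeglin2016Balls, Part 2 §1.1] -/
theorem hermForm_eq_zero_symm_of_transpose_map_eq {m : Type*} [Fintype m] [DecidableEq m] (σ : R →+* R)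
    {H : Matrix m m R} (hσ : ∀ x, σ (σ x) = x) (hH : (H.map σ)ᵀ = H) (u v : m → R)
    (h : hermForm σ H u v = 0) : hermForm σ H v u = 0 := by
  rw [hermForm_eq_unitaryGroupHermForm] at h ⊢
  rw [← UnitaryGroup.conj_hermForm σ H hσ hH u v, h, map_zero]

/-- `Fin.natAdd n (0 : Fin 1) = Fin.last n` (index plumbing). [folklore] -/
private theorem natAdd_zero_fin_one (n : ℕ) : Fin.natAdd n (0 : Fin 1) = Fin.last n := by
  ext; simp

variable {N₁ : ℕ} (J₁ : Matrix (Fin N₁) (Fin N₁) R) (J₂ : Matrix (Fin 1) (Fin 1) R)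

/-- `(J₁ ⊕ᶠ J₂)(castSucc i, castSucc j) = J₁ i j`: the Gram matrix of an orthogonal direct sum in the concatenated basis
([Kudla1984] §1, the direct sums of the see-saw; ★ `UnitaryGroup.finSum`). [cite: Kudla1984, §1] -/
theorem finSum_one_apply_castSucc_castSucc (i j : Fin N₁) :
    UnitaryGroup.finSum N₁ 1 J₁ J₂ (Fin.castSucc i) (Fin.castSucc j) = J₁ i j := by
  show UnitaryGroup.finSum N₁ 1 J₁ J₂ (Fin.castAdd 1 i) (Fin.castAdd 1 j) = J₁ i j
  simp [UnitaryGroup.finSum]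

/-- `(J₁ ⊕ᶠ J₂)(castSucc i, last) = 0`: the two summands are orthogonal. [cite: Kudla1984, §1] -/
theorem finSum_one_apply_castSucc_last (i : Fin N₁) :
    UnitaryGroup.finSum N₁ 1 J₁ J₂ (Fin.castSucc i) (Fin.last N₁) = 0 := by
  rw [← natAdd_zero_fin_one]
  show UnitaryGroup.finSum N₁ 1 J₁ J₂ (Fin.castAdd 1 i) (Fin.natAdd N₁ 0) = 0
  simp [UnitaryGroup.finSum]

/-- `(J₁ ⊕ᶠ J₂)(last, castSucc j) = 0`: the two summands are orthogonal. [cite: Kudla1984, §1] -/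
theorem finSum_one_apply_last_castSucc (j : Fin N₁) :
    UnitaryGroup.finSum N₁ 1 J₁ J₂ (Fin.last N₁) (Fin.castSucc j) = 0 := by
  rw [← natAdd_zero_fin_one]
  show UnitaryGroup.finSum N₁ 1 J₁ J₂ (Fin.natAdd N₁ 0) (Fin.castAdd 1 j) = 0
  simp [UnitaryGroup.finSum]

/-- `(J₁ ⊕ᶠ J₂)(last, last) = J₂ 0 0`: the Gram matrix of the second (one-dimensional) summand. [cite: Kudla1984, §1] -/
theorem finSum_one_apply_last_last :
    UnitaryGroup.finSum N₁ 1 J₁ J₂ (Fin.last N₁) (Fin.last N₁) = J₂ 0 0 := by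
  rw [← natAdd_zero_fin_one]
  simp [UnitaryGroup.finSum]

end Entries

/-! ## §2 The frame through an anisotropic vector -/

section Frame

variable {E : Type*} [Field E] (σ : E →+* E) {n : ℕ}

/-- **A frame adapted to an anisotropic vector.**  Let `⟨u,v⟩ = ᵗσ(u)·H·v` on `E^{n+1}` be symmetric with respect
to vanishing (`⟨u,v⟩ = 0 → ⟨v,u⟩ = 0`) and let `⟨w,w⟩ ≠ 0`.  Then there are `J⋆ ∈ M_n(E)` and `B ∈ GL_{n+1}(E)` with
block-diagonal Gram matrix `ᵗσ(B)·H·B = J⋆ ⊕ᶠ (⟨w,w⟩)`, last column `B e_last = w`, first `n` columns `H`-orthogonal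
to `w`, and every `v` with `⟨w,v⟩ = 0` in the span of the first `n` columns (they are a basis of `w^⊥`, the kernel of
the non-zero functional `v ↦ ⟨w,v⟩`, of dimension `n`; `w ∉ w^⊥`). [cite: BergeronMillsonMoeglin2016Balls, Part 2 §3.1]
[cite: Milne2005ShimuraVarieties, Def. 12.5 and Rem. 12.6 p. 113] -/
theorem exists_frame_formCongr_eq_finSum_of_hermForm_self_ne_zero (H : Matrix (Fin (n + 1)) (Fin (n + 1)) E)
    (hsymm : ∀ u v : Fin (n + 1) → E, hermForm σ H u v = 0 → hermForm σ H v u = 0)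
    (w : Fin (n + 1) → E) (hw : hermForm σ H w w ≠ 0) :
    ∃ (Jstar : Matrix (Fin n) (Fin n) E) (B : GL (Fin (n + 1)) E),
      formCongr σ B H = UnitaryGroup.finSum n 1 Jstar !![hermForm σ H w w] ∧
      (∀ i, (B : Matrix (Fin (n + 1)) (Fin (n + 1)) E) i (Fin.last n) = w i) ∧
      (∀ j : Fin n, hermForm σ H w (fun i => (B : Matrix (Fin (n + 1)) (Fin (n + 1)) E) i (Fin.castSucc j)) = 0) ∧
      ∀ v : Fin (n + 1) → E, hermForm σ H w v = 0 →
        v ∈ Submodule.span E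
          (Set.range fun j : Fin n => fun i => (B : Matrix (Fin (n + 1)) (Fin (n + 1)) E) i (Fin.castSucc j)) := by
  classical
  -- the functional `v ↦ ⟨w, v⟩`, its kernel `w^⊥`, `w ∉ w^⊥`
  set f : (Fin (n + 1) → E) →ₗ[E] E := Matrix.toLinearMapₛₗ₂' E σ (RingHom.id E) H w with hf_def
  have hf : ∀ v, f v = hermForm σ H w v := fun v => UnitaryGroup.toLinearMapₛₗ₂'_eq_hermForm σ H w v
  set Wp : Submodule E (Fin (n + 1) → E) := LinearMap.ker f with hWp
  have hmemWp : ∀ v, v ∈ Wp ↔ hermForm σ H w v = 0 := fun v => by rw [hWp, LinearMap.mem_ker, hf]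
  have hw_not : w ∉ Wp := fun h => hw ((hmemWp w).1 h)
  -- `f` is onto `E`, so `dim w^⊥ = n`
  have hrange : LinearMap.range f = ⊤ := by
    refine LinearMap.range_eq_top.2 fun c => ⟨(c * (hermForm σ H w w)⁻¹) • w, ?_⟩
    rw [map_smul, hf, smul_eq_mul, inv_mul_cancel_right₀ hw]
  have hfinrank : Module.finrank E Wp = n := by
    have h := f.finrank_range_add_finrank_ker
    rw [hrange, finrank_top, Module.finrank_self, Module.finrank_fin_fun] at h
    rw [hWp]
    omega
  -- a basis of `w^⊥`; the columns `(b₁ | … | bₙ | w)`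
  let bW : Module.Basis (Fin n) E Wp := Module.finBasisOfFinrankEq E Wp hfinrank
  have hbW_li : LinearIndependent E (fun j => (bW j : Fin (n + 1) → E)) :=
    bW.linearIndependent.map' Wp.subtype (Submodule.ker_subtype Wp)
  have hspan : Submodule.span E (Set.range fun j => (bW j : Fin (n + 1) → E)) = Wp := by
    have h := congrArg (Submodule.map Wp.subtype) bW.span_eq
    rw [Submodule.map_span, Submodule.map_top, Submodule.range_subtype, ← Set.range_comp] at h
    exact h
  set cols : Fin (n + 1) → (Fin (n + 1) → E) := Fin.snoc (fun j => (bW j : Fin (n + 1) → E)) w with hcols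
  have hcols_cs : ∀ j : Fin n, cols (Fin.castSucc j) = (bW j : Fin (n + 1) → E) := fun j => by
    simp [hcols]
  have hcols_last : cols (Fin.last n) = w := by simp [hcols]
  have hli : LinearIndependent E cols := by
    rw [hcols, linearIndependent_finSnoc, hspan]
    exact ⟨hbW_li, hw_not⟩
  -- the frame as an invertible matrix
  set b : Matrix (Fin (n + 1)) (Fin (n + 1)) E := Matrix.of fun i k => cols k i with hb
  have hbcol : ∀ k, (fun i => b i k) = cols k := fun k => rfl
  have hU : IsUnit b := Matrix.linearIndependent_cols_iff_isUnit.1 hli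
  have hdet : b.det ≠ 0 := ((Matrix.isUnit_iff_isUnit_det b).1 hU).ne_zero
  set B : GL (Fin (n + 1)) E := Matrix.GeneralLinearGroup.mkOfDetNeZero b hdet with hB
  have hBcoe : (B : Matrix (Fin (n + 1)) (Fin (n + 1)) E) = b := rfl
  -- orthogonality of the first `n` columns to `w`
  have horth : ∀ j : Fin n, hermForm σ H w (cols (Fin.castSucc j)) = 0 := fun j => by
    rw [hcols_cs, ← hmemWp]
    exact (bW j).2
  have horth' : ∀ j : Fin n, hermForm σ H (cols (Fin.castSucc j)) w = 0 := fun j => hsymm _ _ (horth j)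
  refine ⟨Matrix.of fun j j' => hermForm σ H (cols (Fin.castSucc j)) (cols (Fin.castSucc j')), B, ?_, ?_, ?_, ?_⟩
  · -- the Gram matrix is block diagonal
    ext k l
    rw [formCongr_apply_eq_hermForm, hBcoe, hbcol, hbcol]
    induction k using Fin.lastCases with
    | last =>
      induction l using Fin.lastCases with
      | last => rw [hcols_last, finSum_one_apply_last_last]; simp
      | cast j => rw [hcols_last, finSum_one_apply_last_castSucc, horth]
    | cast j =>
      induction l using Fin.lastCases with
      | last => rw [hcols_last, finSum_one_apply_castSucc_last, horth']
      | cast j' => rw [finSum_one_apply_castSucc_castSucc, Matrix.of_apply]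
  · -- last column
    intro i
    rw [hBcoe]
    exact congrFun hcols_last i
  · -- first `n` columns are orthogonal to `w`
    intro j
    exact horth j
  · -- and span `w^⊥`
    intro v hv
    have hfun : (Set.range fun j : Fin n => fun i => (B : Matrix (Fin (n + 1)) (Fin (n + 1)) E) i (Fin.castSucc j)) =
        Set.range fun j => (bW j : Fin (n + 1) → E) := by
      congr 1
      funext j
      exact hcols_cs j
    rw [hfun, hspan]
    exact (hmemWp v).2 hv

/-- The same frame for `σ` an INVOLUTION and `H` `σ`-HERMITIAN (`ᵗσ(H) = H`), the hypotheses of the tree's unitary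
groups: `ᵗσ(B)·H·B = J⋆ ⊕ᶠ (⟨w,w⟩)`, last column `w`, first `n` columns a basis of `w^⊥`.
[cite: BergeronMillsonMoeglin2016Balls, Part 2 §3.1] [cite: Milne2005ShimuraVarieties, Def. 12.5 and Rem. 12.6 p. 113] -/
theorem exists_frame_formCongr_eq_finSum_of_isHermitian (H : Matrix (Fin (n + 1)) (Fin (n + 1)) E)
    (hσ : ∀ x, σ (σ x) = x) (hH : (H.map σ)ᵀ = H) (w : Fin (n + 1) → E) (hw : hermForm σ H w w ≠ 0) :
    ∃ (Jstar : Matrix (Fin n) (Fin n) E) (B : GL (Fin (n + 1)) E),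
      formCongr σ B H = UnitaryGroup.finSum n 1 Jstar !![hermForm σ H w w] ∧
      (∀ i, (B : Matrix (Fin (n + 1)) (Fin (n + 1)) E) i (Fin.last n) = w i) ∧
      (∀ j : Fin n, hermForm σ H w (fun i => (B : Matrix (Fin (n + 1)) (Fin (n + 1)) E) i (Fin.castSucc j)) = 0) ∧
      ∀ v : Fin (n + 1) → E, hermForm σ H w v = 0 →
        v ∈ Submodule.span E
          (Set.range fun j : Fin n => fun i => (B : Matrix (Fin (n + 1)) (Fin (n + 1)) E) i (Fin.castSucc j)) :=
  exists_frame_formCongr_eq_finSum_of_hermForm_self_ne_zero σ H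
    (hermForm_eq_zero_symm_of_transpose_map_eq σ hσ hH) w hw

end Frame

/-! ## §3 The frame of a totally positive definite line -/

section Line

variable {E : Type*} [Field E] [NumberField E] (σ : E →+* E) {n : ℕ}

/-- A totally positive definite subspace is anisotropic: `w ∈ W`, `w ≠ 0` gives `⟨w,w⟩ ≠ 0` (its real part is
positive at any complex embedding, and a number field has one). [cite: BergeronMillsonMoeglin2016Balls, Introduction §1.7] -/
theorem IsTotallyPositive.hermForm_self_ne_zero {m : Type*} [Fintype m] [DecidableEq m] {H : Matrix m m E}
    {W : Submodule E (m → E)} (hW : IsTotallyPositive σ H W) {w : m → E} (hwW : w ∈ W) (hw0 : w ≠ 0) :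
    hermForm σ H w w ≠ 0 := by
  obtain ⟨τ⟩ := (inferInstance : Nonempty (E →+* ℂ))
  intro h
  have := hW w hwW hw0 τ
  rw [h, map_zero, Complex.zero_re] at this
  exact lt_irrefl _ this

/-- **The frame of a totally positive definite line** (A-plan2 GS-programme F3, for every `n`).  For `⟨u,v⟩ = ᵗσ(u)·H·v`
symmetric with respect to vanishing and a totally positive definite line `W ⊆ E^{n+1}` (★ `IsTotallyPositive`,
`finrank W = 1`) there are `J⋆ ∈ M_n(E)`, `J⊥ ∈ M_1(E)` and `B ∈ GL_{n+1}(E)` with `ᵗσ(B)·H·B = J⋆ ⊕ᶠ J⊥`,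
`0 < Re τ(J⊥₀₀)` at every complex embedding `τ` (`J⊥₀₀ = ⟨w,w⟩` for the generator `w = B e_last` of `W`), the last
column of `B` spanning `W`, the first `n` columns `H`-orthogonal to `W`, and `W^⊥` spanned by them — the orthogonal
decomposition `E^{n+1} = W^⊥ ⊕ W` read in a frame. [cite: BergeronMillsonMoeglin2016Balls, Part 2 §3.1]
[cite: Milne2005ShimuraVarieties, Def. 12.5 and Rem. 12.6 p. 113] -/
theorem exists_frame_formCongr_eq_finSum_of_isTotallyPositive (H : Matrix (Fin (n + 1)) (Fin (n + 1)) E)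
    (hsymm : ∀ u v : Fin (n + 1) → E, hermForm σ H u v = 0 → hermForm σ H v u = 0)
    (W : Submodule E (Fin (n + 1) → E)) (hW : IsTotallyPositive σ H W) (h1 : Module.finrank E W = 1) :
    ∃ (Jstar : Matrix (Fin n) (Fin n) E) (Jperp : Matrix (Fin 1) (Fin 1) E) (B : GL (Fin (n + 1)) E),
      formCongr σ B H = UnitaryGroup.finSum n 1 Jstar Jperp ∧
      (∀ τ : E →+* ℂ, 0 < (τ (Jperp 0 0)).re) ∧
      Submodule.span E {fun i => (B : Matrix (Fin (n + 1)) (Fin (n + 1)) E) i (Fin.last n)} = W ∧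
      (∀ v ∈ W, ∀ j : Fin n,
        hermForm σ H v (fun i => (B : Matrix (Fin (n + 1)) (Fin (n + 1)) E) i (Fin.castSucc j)) = 0) ∧
      ∀ v : Fin (n + 1) → E, (∀ u ∈ W, hermForm σ H u v = 0) →
        v ∈ Submodule.span E
          (Set.range fun j : Fin n => fun i => (B : Matrix (Fin (n + 1)) (Fin (n + 1)) E) i (Fin.castSucc j)) := by
  classical
  -- a generator of the line
  have hWbot : W ≠ ⊥ := fun h => by rw [h, finrank_bot] at h1; exact zero_ne_one h1
  obtain ⟨w, hwW, hw0⟩ := Submodule.exists_mem_ne_zero_of_ne_bot hWbot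
  have hspanW : Submodule.span E {w} = W :=
    Submodule.eq_of_le_of_finrank_eq ((Submodule.span_singleton_le_iff_mem w W).2 hwW)
      (by rw [finrank_span_singleton hw0, h1])
  have hw : hermForm σ H w w ≠ 0 := hW.hermForm_self_ne_zero σ hwW hw0
  obtain ⟨Jstar, B, hB, hlast, horth, hperp⟩ :=
    exists_frame_formCongr_eq_finSum_of_hermForm_self_ne_zero σ H hsymm w hw
  have hlast' : (fun i => (B : Matrix (Fin (n + 1)) (Fin (n + 1)) E) i (Fin.last n)) = w := funext hlast
  refine ⟨Jstar, !![hermForm σ H w w], B, hB, fun τ => ?_, by rw [hlast', hspanW], fun v hv j => ?_, fun v hv => ?_⟩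
  · simpa using hW w hwW hw0 τ
  · rw [← hspanW, Submodule.mem_span_singleton] at hv
    obtain ⟨c, rfl⟩ := hv
    rw [hermForm_eq_unitaryGroupHermForm, UnitaryGroup.hermForm_smul_left_eq, ← hermForm_eq_unitaryGroupHermForm,
      horth j, mul_zero]
  · exact hperp v (hv w hwW)

/-- The line frame for `σ` an involution and `H` `σ`-hermitian entrywise (`σ(H i j) = H j i`, the `isHermitian` field
of the tree's hermitian data), e.g. a CM field with its complex conjugation: `ᵗσ(B)·H·B = J⋆ ⊕ᶠ J⊥` with `J⊥₀₀`
totally positive, last column spanning `W`, first `n` columns spanning `W^⊥`.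
[cite: BergeronMillsonMoeglin2016Balls, Part 2 §3.1] [cite: Milne2005ShimuraVarieties, Def. 12.5 and Rem. 12.6 p. 113] -/
theorem exists_frame_formCongr_eq_finSum_of_isTotallyPositive_of_isHermitian
    (H : Matrix (Fin (n + 1)) (Fin (n + 1)) E) (hσ : ∀ x, σ (σ x) = x) (hH : ∀ i j, σ (H i j) = H j i)
    (W : Submodule E (Fin (n + 1) → E)) (hW : IsTotallyPositive σ H W) (h1 : Module.finrank E W = 1) :
    ∃ (Jstar : Matrix (Fin n) (Fin n) E) (Jperp : Matrix (Fin 1) (Fin 1) E) (B : GL (Fin (n + 1)) E),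
      formCongr σ B H = UnitaryGroup.finSum n 1 Jstar Jperp ∧
      (∀ τ : E →+* ℂ, 0 < (τ (Jperp 0 0)).re) ∧
      Submodule.span E {fun i => (B : Matrix (Fin (n + 1)) (Fin (n + 1)) E) i (Fin.last n)} = W ∧
      (∀ v ∈ W, ∀ j : Fin n,
        hermForm σ H v (fun i => (B : Matrix (Fin (n + 1)) (Fin (n + 1)) E) i (Fin.castSucc j)) = 0) ∧
      ∀ v : Fin (n + 1) → E, (∀ u ∈ W, hermForm σ H u v = 0) →
        v ∈ Submodule.span E
          (Set.range fun j : Fin n => fun i => (B : Matrix (Fin (n + 1)) (Fin (n + 1)) E) i (Fin.castSucc j)) :=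
  exists_frame_formCongr_eq_finSum_of_isTotallyPositive σ H
    (hermForm_eq_zero_symm_of_transpose_map_eq σ hσ (transpose_map_eq_of_forall_map_apply σ hH)) W hW h1

end Line

/-! ## §4 The complex frame of `W^⊥`: `Mᴴ·H^τ·M = J⋆^τ` and `M(ℂⁿ) ⊥ τ(W)` -/

section ComplexFrame

variable {E : Type*} [Field E] (σ : E →+* E) {n : ℕ} (τ : E →+* ℂ)

/-- Entries of `Mᴴ·Hc·M` for a rectangular complex matrix `M`: the pairings `⟨M e_j, M e_j'⟩` of its columns for the
complex hermitian form with Gram matrix `Hc` (BMM Part 2 §1.1, the form `V_τ = V ⊗_{E,τ} ℂ` in coordinates).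
[cite: BergeronMillsonMoeglin2016Balls, Part 2 §1.1] -/
theorem conjTranspose_mul_mul_apply {m k : Type*} [Fintype m] (Hc : Matrix m m ℂ) (M : Matrix m k ℂ) (j j' : k) :
    (M.conjTranspose * Hc * M) j j' = hermForm (starRingEnd ℂ) Hc (fun i => M i j) (fun i => M i j') := by
  rw [Matrix.mul_assoc, Matrix.mul_apply]
  rfl

/-- **The complex frame of `W^⊥` is isometric onto `J⋆^τ`.**  If `ᵗσ(B)·H·B = J⋆ ⊕ᶠ J⊥` and `τ : E →+* ℂ`
intertwines `σ` with complex conjugation, then the complex `(n+1) × n` matrix `M = τ(B·(e₁ | … | eₙ))` of the first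
`n` columns satisfies `Mᴴ·H^τ·M = J⋆^τ` (the `gram` clause of a compatible embedding `(ℂⁿ, J⋆^τ) ↪ (ℂ^{n+1}, H^τ)`).
[cite: BergeronMillsonMoeglin2016Balls, Part 2 §3.1] -/
theorem conjTranspose_mul_map_mul_eq_map_of_formCongr_eq_finSum (hτ : ∀ x, τ (σ x) = starRingEnd ℂ (τ x))
    {H : Matrix (Fin (n + 1)) (Fin (n + 1)) E} {B : GL (Fin (n + 1)) E} {Jstar : Matrix (Fin n) (Fin n) E}
    {Jperp : Matrix (Fin 1) (Fin 1) E} (hB : formCongr σ B H = UnitaryGroup.finSum n 1 Jstar Jperp) :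
    (((B : Matrix (Fin (n + 1)) (Fin (n + 1)) E).submatrix id Fin.castSucc).map τ).conjTranspose * H.map τ *
        ((B : Matrix (Fin (n + 1)) (Fin (n + 1)) E).submatrix id Fin.castSucc).map τ = Jstar.map τ := by
  ext j j'
  rw [conjTranspose_mul_mul_apply, Matrix.map_apply, ← finSum_one_apply_castSucc_castSucc Jstar Jperp j j',
    ← hB, formCongr_apply_eq_hermForm, map_hermForm τ hτ]
  rfl

/-- **The complex frame of `W^⊥` is orthogonal to `τ(v)`** whenever the first `n` columns of `B` are `H`-orthogonal
to `v`: `⟨τ v, M x⟩_{H^τ} = 0` for every `x ∈ ℂⁿ` (the `orthogonal` clause of a compatible embedding).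
[cite: BergeronMillsonMoeglin2016Balls, Part 2 §3.1] -/
theorem hermForm_map_mulVec_eq_zero_of_forall_hermForm_eq_zero (hτ : ∀ x, τ (σ x) = starRingEnd ℂ (τ x))
    {H : Matrix (Fin (n + 1)) (Fin (n + 1)) E} {B : GL (Fin (n + 1)) E} {v : Fin (n + 1) → E}
    (horth : ∀ j : Fin n, hermForm σ H v (fun i => (B : Matrix (Fin (n + 1)) (Fin (n + 1)) E) i (Fin.castSucc j)) = 0)
    (x : Fin n → ℂ) :
    hermForm (starRingEnd ℂ) (H.map τ) (τ ∘ v)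
      ((((B : Matrix (Fin (n + 1)) (Fin (n + 1)) E).submatrix id Fin.castSucc).map τ) *ᵥ x) = 0 := by
  have hrow : star (⇑τ ∘ v) ᵥ* H.map τ ᵥ*
      ((B : Matrix (Fin (n + 1)) (Fin (n + 1)) E).submatrix id Fin.castSucc).map τ = 0 := by
    funext j
    have h' := congrArg τ (horth j)
    rw [map_hermForm τ hτ, map_zero, hermForm_starRingEnd, Matrix.dotProduct_mulVec] at h'
    exact h'
  rw [hermForm_starRingEnd, Matrix.mulVec_mulVec, Matrix.dotProduct_mulVec, ← Matrix.vecMul_vecMul, hrow,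
    zero_dotProduct]

end ComplexFrame

end Literature.AlgebraicGeometry.ShimuraVarieties

end
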